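import Summits.AnomalousDissipation.AnomalousDissipation.Theorems.SolenoidalFractalHomogenisationLagrangianStepCellChainSlotFrame
import Summits.AnomalousDissipation.AnomalousDissipation.Theorems.SolenoidalFractalHomogenisationLagrangianStepCellChainSlotWindow
import HarnessLib

/-!
# K1L_D (stmt-AnomalousDissipation-27980), (ℓ3) (D-TH)₀ — W7 engine sub-piece S1a AT A FROZEN FRAME `G₀`: the gauged twisted three-mode chain on the
# ABSOLUTE-TIME WINDOW of slot `s` in period `p`, link `= c_s · A_s(t)` (helper; `--supports stmt-AnomalousDissipation-27980 --as helper`)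

Port plan B8 (`HOME/ad-sawtooth-k1loc-p1/g16/W7thg-portplan-k1locp1g16.md`; prover ad-sawtooth-k1loc-p1 g16): the frozen-frame twin of w1's flat
`…CellChainSlotWindow` under the dictionary `transversalProj k ↦ transversalProjR (twistFreq G₀ k)`, `modeRep ↦ modeRepθ`,
`modalAdjGen 𝔹ᵀ K w ↦ 4π² • P^θ_K T_{(𝔹^{G₀})ᵀ}(K) w`, `dW0C/dWpC/dWmC ↦ dW0R/dWpR/dWmR` (`…W7ThreeModeDefsR`).  Setting:
`h : IsWeakTensorPassiveVectorDistortedOn 0 T 𝔹 (W₁.cell n) (fun _ _ => G₀) F u`.  The window bookkeeping `slot_window`, `sgn_choice` of the flat file is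
frame-free and reused BY NAME.
* **`ae_hasDerivAt_window_dW0R_frame / _dWpR_frame / _dWmR_frame`** — for a.e. `t ∈ (0,T)`, for every period `p`, if `t` is in the window of slot `s` then the
  gauged representatives `w̃ⱼ(t) = μ^j • modeRepθ … (K₀ + j·K_s) t` (`μ = σ·conj e^{iφ_s}`, `σ = ±1`) satisfy the chain shapes with the link
  `l(t) = c_s · A_s^p(t)`, `c_s = σ·(ê_s·K₀)·(1/n)/(2|m_s|)` CONSTANT and dampings `ỹⱼ = 4π² • P^θ_{Kⱼ} T_{(𝔹^{G₀})ᵀ}(Kⱼ) w̃ⱼ`;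
* `ae_hasDerivAt_window_chain_frame` — the same for every `j : ℤ`.
Everything proved; no definitions, no named facts, no sorry.  NOT a proof of `stub_W7thg`, of K1L_D or of AD; rung F-D1.A0 infrastructure.
[cite: MeshalkinSinai1961, pp. 1700–1705] [cite: BedrossianCotiZelati2017, §2] [problem: turb]
-/

set_option linter.dupNamespace false

noncomputable section

namespace Summit.AnomalousDissipation.AnomalousDissipation.Theorems.SolenoidalFractalHomogenisation.LagrangianStep.CellChain

open Set MeasureTheory Filter Topology Function Complex UnitAddTorus
open scoped InnerProductSpace ComplexConjugate
open Literature.Analysis Literature.Analysis.FunctionSpaces Literature.Analysis.FunctionSpaces.Torus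
open Literature.Analysis.FluidPDE Literature.Analysis.FluidPDE.Torus Literature.Analysis.FluidPDE.LatticeShear
open Summit.AnomalousDissipation.AnomalousDissipation.Theorems.SolenoidalFractalHomogenisation.RealisedQuasiStaticCellLaw
open Summit.AnomalousDissipation.AnomalousDissipation.Theorems.SolenoidalFractalHomogenisation.PermissibleCarrier
open Summit.AnomalousDissipation.AnomalousDissipation.Theorems.SolenoidalFractalHomogenisation.LagrangianStep.ThreeMode

variable {k₀ : ℕ}

/-- **Mode `0` on the window of slot `s`, period `p`, frozen frame**: `HasDerivAt w̃₀ (dW0R (c_s·A_s^p t) (Torus.twistFreq G₀ K₀) w̃₁ w̃₋₁ ỹ₀) t` for a.e. `t` in the window, all `p` at once,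
`c_s = σ(ê_s·K₀)(1/n)/(2|m_s|)`, `A_s^p t = trapezoid (pP + start s) τ_s ramp t`. [cite: BedrossianCotiZelati2017, §2 (hypocoercivity functional with a cross term)] -/
theorem ae_hasDerivAt_window_dW0R_frame (W₁ : LatticeWord k₀) (n : ℕ) {T : ℝ} (hT : 0 ≤ T) {𝔹 : Torus.Visc4 (Fin 3)}
    {G₀ : Matrix (Fin 3) (Fin 3) ℝ} {F : UnitAddTorus (Fin 3) → EuclideanSpace ℝ (Fin 3)} {u : ℝ → UnitAddTorus (Fin 3) → EuclideanSpace ℝ (Fin 3)}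
    (h : Torus.IsWeakTensorPassiveVectorDistortedOn 0 T 𝔹 (W₁.cell n) (fun _ _ => G₀) F u) (hF : Integrable F volume) (s : Fin k₀) (K0 : Fin 3 → ℤ)
    {σ : ℝ} (hσ : σ = 1 ∨ σ = -1) :
    ∀ᵐ t ∂(volume.restrict (Ioo 0 T)), ∀ p : ℤ,
      t ∈ Ico (p * W₁.period + W₁.start s) (p * W₁.period + W₁.start s + (W₁.phase s).τ) →
      HasDerivAt (fun x => ((σ : ℂ) * starRingEnd ℂ (Complex.exp ((W₁.phase s).φ * Complex.I))) ^ (0:ℤ) • modeRepθ W₁ n 𝔹 G₀ F u (K0 + (0:ℤ) • (fun i => (W₁.phase s).m i * (n : ℤ))) x)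
        (dW0R ((σ * (∑ a, (W₁.phase s).e a * (K0 a : ℝ)) * (1 / (n : ℝ)) / (2 * ‖latticeVec (W₁.phase s).m‖)) * LatticeWord.trapezoid (p * W₁.period + W₁.start s) (W₁.phase s).τ W₁.ramp t) (Torus.twistFreq G₀ (K0 + (0:ℤ) • (fun i => (W₁.phase s).m i * (n : ℤ))))
          (((σ : ℂ) * starRingEnd ℂ (Complex.exp ((W₁.phase s).φ * Complex.I))) ^ (1:ℤ) • modeRepθ W₁ n 𝔹 G₀ F u (K0 + (1:ℤ) • (fun i => (W₁.phase s).m i * (n : ℤ))) t)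
          (((σ : ℂ) * starRingEnd ℂ (Complex.exp ((W₁.phase s).φ * Complex.I))) ^ (-1:ℤ) • modeRepθ W₁ n 𝔹 G₀ F u (K0 + (-1:ℤ) • (fun i => (W₁.phase s).m i * (n : ℤ))) t)
          (((4 * Real.pi ^ 2 : ℝ) : ℂ) • Torus.transversalProjR (Torus.twistFreq G₀ (K0 + (0:ℤ) • (fun i => (W₁.phase s).m i * (n : ℤ)))) (Torus.symbT (Torus.majorTranspose (Torus.Visc4.conj G₀ 𝔹)) (K0 + (0:ℤ) • (fun i => (W₁.phase s).m i * (n : ℤ))) (((σ : ℂ) * starRingEnd ℂ (Complex.exp ((W₁.phase s).φ * Complex.I))) ^ (0:ℤ) • modeRepθ W₁ n 𝔹 G₀ F u (K0 + (0:ℤ) • (fun i => (W₁.phase s).m i * (n : ℤ))) t)))) t := by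
  filter_upwards [ae_hasDerivAt_gauged_dW0R_frame W₁ n hT h hF s K0 hσ] with t ht p hp
  obtain ⟨_, hslot, htrap⟩ := slot_window W₁ s p hp
  have h0 := ht hslot
  rw [htrap] at h0
  rw [show σ * ((∑ a, (W₁.phase s).e a * (K0 a : ℝ)) * ((1 / (n : ℝ)) * LatticeWord.trapezoid (p * W₁.period + W₁.start s) (W₁.phase s).τ W₁.ramp t) / (2 * ‖latticeVec (W₁.phase s).m‖)) = (σ * (∑ a, (W₁.phase s).e a * (K0 a : ℝ)) * (1 / (n : ℝ)) / (2 * ‖latticeVec (W₁.phase s).m‖)) * LatticeWord.trapezoid (p * W₁.period + W₁.start s) (W₁.phase s).τ W₁.ramp t by ring] at h0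
  exact h0

/-- **Mode `+1` on the window**: `HasDerivAt w̃₁ (dWpR (c_s·A_s^p t) (Torus.twistFreq G₀ K₁) w̃₀ w̃₂ ỹ₁) t`. [cite: BedrossianCotiZelati2017, §2 (hypocoercivity functional with a cross term)] -/
theorem ae_hasDerivAt_window_dWpR_frame (W₁ : LatticeWord k₀) (n : ℕ) {T : ℝ} (hT : 0 ≤ T) {𝔹 : Torus.Visc4 (Fin 3)}
    {G₀ : Matrix (Fin 3) (Fin 3) ℝ} {F : UnitAddTorus (Fin 3) → EuclideanSpace ℝ (Fin 3)} {u : ℝ → UnitAddTorus (Fin 3) → EuclideanSpace ℝ (Fin 3)}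
    (h : Torus.IsWeakTensorPassiveVectorDistortedOn 0 T 𝔹 (W₁.cell n) (fun _ _ => G₀) F u) (hF : Integrable F volume) (s : Fin k₀) (K0 : Fin 3 → ℤ)
    {σ : ℝ} (hσ : σ = 1 ∨ σ = -1) :
    ∀ᵐ t ∂(volume.restrict (Ioo 0 T)), ∀ p : ℤ,
      t ∈ Ico (p * W₁.period + W₁.start s) (p * W₁.period + W₁.start s + (W₁.phase s).τ) →
      HasDerivAt (fun x => ((σ : ℂ) * starRingEnd ℂ (Complex.exp ((W₁.phase s).φ * Complex.I))) ^ (1:ℤ) • modeRepθ W₁ n 𝔹 G₀ F u (K0 + (1:ℤ) • (fun i => (W₁.phase s).m i * (n : ℤ))) x)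
        (dWpR ((σ * (∑ a, (W₁.phase s).e a * (K0 a : ℝ)) * (1 / (n : ℝ)) / (2 * ‖latticeVec (W₁.phase s).m‖)) * LatticeWord.trapezoid (p * W₁.period + W₁.start s) (W₁.phase s).τ W₁.ramp t) (Torus.twistFreq G₀ (K0 + (1:ℤ) • (fun i => (W₁.phase s).m i * (n : ℤ))))
          (((σ : ℂ) * starRingEnd ℂ (Complex.exp ((W₁.phase s).φ * Complex.I))) ^ (0:ℤ) • modeRepθ W₁ n 𝔹 G₀ F u (K0 + (0:ℤ) • (fun i => (W₁.phase s).m i * (n : ℤ))) t)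
          (((σ : ℂ) * starRingEnd ℂ (Complex.exp ((W₁.phase s).φ * Complex.I))) ^ (2:ℤ) • modeRepθ W₁ n 𝔹 G₀ F u (K0 + (2:ℤ) • (fun i => (W₁.phase s).m i * (n : ℤ))) t)
          (((4 * Real.pi ^ 2 : ℝ) : ℂ) • Torus.transversalProjR (Torus.twistFreq G₀ (K0 + (1:ℤ) • (fun i => (W₁.phase s).m i * (n : ℤ)))) (Torus.symbT (Torus.majorTranspose (Torus.Visc4.conj G₀ 𝔹)) (K0 + (1:ℤ) • (fun i => (W₁.phase s).m i * (n : ℤ))) (((σ : ℂ) * starRingEnd ℂ (Complex.exp ((W₁.phase s).φ * Complex.I))) ^ (1:ℤ) • modeRepθ W₁ n 𝔹 G₀ F u (K0 + (1:ℤ) • (fun i => (W₁.phase s).m i * (n : ℤ))) t)))) t := by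
  filter_upwards [ae_hasDerivAt_gauged_dWpR_frame W₁ n hT h hF s K0 hσ] with t ht p hp
  obtain ⟨_, hslot, htrap⟩ := slot_window W₁ s p hp
  have h0 := ht hslot
  rw [htrap] at h0
  rw [show σ * ((∑ a, (W₁.phase s).e a * (K0 a : ℝ)) * ((1 / (n : ℝ)) * LatticeWord.trapezoid (p * W₁.period + W₁.start s) (W₁.phase s).τ W₁.ramp t) / (2 * ‖latticeVec (W₁.phase s).m‖)) = (σ * (∑ a, (W₁.phase s).e a * (K0 a : ℝ)) * (1 / (n : ℝ)) / (2 * ‖latticeVec (W₁.phase s).m‖)) * LatticeWord.trapezoid (p * W₁.period + W₁.start s) (W₁.phase s).τ W₁.ramp t by ring] at h0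
  exact h0

/-- **Mode `−1` on the window**: `HasDerivAt w̃₋₁ (dWmR (c_s·A_s^p t) (Torus.twistFreq G₀ K₋₁) w̃₀ w̃₋₂ ỹ₋₁) t`. [cite: BedrossianCotiZelati2017, §2 (hypocoercivity functional with a cross term)] -/
theorem ae_hasDerivAt_window_dWmR_frame (W₁ : LatticeWord k₀) (n : ℕ) {T : ℝ} (hT : 0 ≤ T) {𝔹 : Torus.Visc4 (Fin 3)}
    {G₀ : Matrix (Fin 3) (Fin 3) ℝ} {F : UnitAddTorus (Fin 3) → EuclideanSpace ℝ (Fin 3)} {u : ℝ → UnitAddTorus (Fin 3) → EuclideanSpace ℝ (Fin 3)}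
    (h : Torus.IsWeakTensorPassiveVectorDistortedOn 0 T 𝔹 (W₁.cell n) (fun _ _ => G₀) F u) (hF : Integrable F volume) (s : Fin k₀) (K0 : Fin 3 → ℤ)
    {σ : ℝ} (hσ : σ = 1 ∨ σ = -1) :
    ∀ᵐ t ∂(volume.restrict (Ioo 0 T)), ∀ p : ℤ,
      t ∈ Ico (p * W₁.period + W₁.start s) (p * W₁.period + W₁.start s + (W₁.phase s).τ) →
      HasDerivAt (fun x => ((σ : ℂ) * starRingEnd ℂ (Complex.exp ((W₁.phase s).φ * Complex.I))) ^ (-1:ℤ) • modeRepθ W₁ n 𝔹 G₀ F u (K0 + (-1:ℤ) • (fun i => (W₁.phase s).m i * (n : ℤ))) x)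
        (dWmR ((σ * (∑ a, (W₁.phase s).e a * (K0 a : ℝ)) * (1 / (n : ℝ)) / (2 * ‖latticeVec (W₁.phase s).m‖)) * LatticeWord.trapezoid (p * W₁.period + W₁.start s) (W₁.phase s).τ W₁.ramp t) (Torus.twistFreq G₀ (K0 + (-1:ℤ) • (fun i => (W₁.phase s).m i * (n : ℤ))))
          (((σ : ℂ) * starRingEnd ℂ (Complex.exp ((W₁.phase s).φ * Complex.I))) ^ (0:ℤ) • modeRepθ W₁ n 𝔹 G₀ F u (K0 + (0:ℤ) • (fun i => (W₁.phase s).m i * (n : ℤ))) t)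
          (((σ : ℂ) * starRingEnd ℂ (Complex.exp ((W₁.phase s).φ * Complex.I))) ^ (-2:ℤ) • modeRepθ W₁ n 𝔹 G₀ F u (K0 + (-2:ℤ) • (fun i => (W₁.phase s).m i * (n : ℤ))) t)
          (((4 * Real.pi ^ 2 : ℝ) : ℂ) • Torus.transversalProjR (Torus.twistFreq G₀ (K0 + (-1:ℤ) • (fun i => (W₁.phase s).m i * (n : ℤ)))) (Torus.symbT (Torus.majorTranspose (Torus.Visc4.conj G₀ 𝔹)) (K0 + (-1:ℤ) • (fun i => (W₁.phase s).m i * (n : ℤ))) (((σ : ℂ) * starRingEnd ℂ (Complex.exp ((W₁.phase s).φ * Complex.I))) ^ (-1:ℤ) • modeRepθ W₁ n 𝔹 G₀ F u (K0 + (-1:ℤ) • (fun i => (W₁.phase s).m i * (n : ℤ))) t)))) t := by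
  filter_upwards [ae_hasDerivAt_gauged_dWmR_frame W₁ n hT h hF s K0 hσ] with t ht p hp
  obtain ⟨_, hslot, htrap⟩ := slot_window W₁ s p hp
  have h0 := ht hslot
  rw [htrap] at h0
  rw [show σ * ((∑ a, (W₁.phase s).e a * (K0 a : ℝ)) * ((1 / (n : ℝ)) * LatticeWord.trapezoid (p * W₁.period + W₁.start s) (W₁.phase s).τ W₁.ramp t) / (2 * ‖latticeVec (W₁.phase s).m‖)) = (σ * (∑ a, (W₁.phase s).e a * (K0 a : ℝ)) * (1 / (n : ℝ)) / (2 * ‖latticeVec (W₁.phase s).m‖)) * LatticeWord.trapezoid (p * W₁.period + W₁.start s) (W₁.phase s).τ W₁.ramp t by ring] at h0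
  exact h0

/-- **The general gauged chain on the window** (every `j : ℤ`): derivative `−4π² • P^θ_{Kⱼ} T_{(𝔹^{G₀})ᵀ}(Kⱼ) w̃ⱼ + (c_s·A_s^p t) • P^θ_{Kⱼ}(w̃ⱼ₊₁ − w̃ⱼ₋₁)`.
[cite: MeshalkinSinai1961, pp. 1700–1705] -/
theorem ae_hasDerivAt_window_chain_frame (W₁ : LatticeWord k₀) (n : ℕ) {T : ℝ} (hT : 0 ≤ T) {𝔹 : Torus.Visc4 (Fin 3)}
    {G₀ : Matrix (Fin 3) (Fin 3) ℝ} {F : UnitAddTorus (Fin 3) → EuclideanSpace ℝ (Fin 3)} {u : ℝ → UnitAddTorus (Fin 3) → EuclideanSpace ℝ (Fin 3)}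
    (h : Torus.IsWeakTensorPassiveVectorDistortedOn 0 T 𝔹 (W₁.cell n) (fun _ _ => G₀) F u) (hF : Integrable F volume) (s : Fin k₀) (K0 : Fin 3 → ℤ)
    {σ : ℝ} (hσ : σ = 1 ∨ σ = -1) :
    ∀ᵐ t ∂(volume.restrict (Ioo 0 T)), ∀ p : ℤ,
      t ∈ Ico (p * W₁.period + W₁.start s) (p * W₁.period + W₁.start s + (W₁.phase s).τ) →
      ∀ j : ℤ, HasDerivAt (fun x => ((σ : ℂ) * starRingEnd ℂ (Complex.exp ((W₁.phase s).φ * Complex.I))) ^ j • modeRepθ W₁ n 𝔹 G₀ F u (K0 + j • (fun i => (W₁.phase s).m i * (n : ℤ))) x)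
        (-(((4 * Real.pi ^ 2 : ℝ) : ℂ) • Torus.transversalProjR (Torus.twistFreq G₀ (K0 + j • (fun i => (W₁.phase s).m i * (n : ℤ)))) (Torus.symbT (Torus.majorTranspose (Torus.Visc4.conj G₀ 𝔹)) (K0 + j • (fun i => (W₁.phase s).m i * (n : ℤ))) (((σ : ℂ) * starRingEnd ℂ (Complex.exp ((W₁.phase s).φ * Complex.I))) ^ j • modeRepθ W₁ n 𝔹 G₀ F u (K0 + j • (fun i => (W₁.phase s).m i * (n : ℤ))) t))) +
          (((σ * (∑ a, (W₁.phase s).e a * (K0 a : ℝ)) * (1 / (n : ℝ)) / (2 * ‖latticeVec (W₁.phase s).m‖)) * LatticeWord.trapezoid (p * W₁.period + W₁.start s) (W₁.phase s).τ W₁.ramp t : ℝ) : ℂ) • Torus.transversalProjR (Torus.twistFreq G₀ (K0 + j • (fun i => (W₁.phase s).m i * (n : ℤ))))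
            (((σ : ℂ) * starRingEnd ℂ (Complex.exp ((W₁.phase s).φ * Complex.I))) ^ (j + 1) • modeRepθ W₁ n 𝔹 G₀ F u (K0 + (j + 1) • (fun i => (W₁.phase s).m i * (n : ℤ))) t -
              ((σ : ℂ) * starRingEnd ℂ (Complex.exp ((W₁.phase s).φ * Complex.I))) ^ (j - 1) • modeRepθ W₁ n 𝔹 G₀ F u (K0 + (j - 1) • (fun i => (W₁.phase s).m i * (n : ℤ))) t)) t := by
  filter_upwards [ae_hasDerivAt_gauged_chain_frame W₁ n hT h hF s K0 hσ] with t ht p hp j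
  obtain ⟨_, hslot, htrap⟩ := slot_window W₁ s p hp
  have h0 := ht hslot j
  rw [htrap] at h0
  rw [show σ * ((∑ a, (W₁.phase s).e a * (K0 a : ℝ)) * ((1 / (n : ℝ)) * LatticeWord.trapezoid (p * W₁.period + W₁.start s) (W₁.phase s).τ W₁.ramp t) / (2 * ‖latticeVec (W₁.phase s).m‖)) = (σ * (∑ a, (W₁.phase s).e a * (K0 a : ℝ)) * (1 / (n : ℝ)) / (2 * ‖latticeVec (W₁.phase s).m‖)) * LatticeWord.trapezoid (p * W₁.period + W₁.start s) (W₁.phase s).τ W₁.ramp t by ring] at h0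
  exact h0

end Summit.AnomalousDissipation.AnomalousDissipation.Theorems.SolenoidalFractalHomogenisation.LagrangianStep.CellChain

end
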